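import Mathlib
import Literature.NumberTheory.LFunctions.VinogradovZetaSumEstimate
import HarnessLib

/-!
# Route LiouvilleSarnak — support `AlignedTypeI` (stmt-ValiantsHypothesis-21040), line `characters_mod_2n`:
# the Korobov step for an arbitrary phase with good factors

Brick (B3) of the Korobov side of `HS` (short character sums mod `q = 2^j`).  The tree's `VKZeta.norm_Usum_le`
(Ivić, Theorem 6.2, pp. 156–159) bounds the bilinear Weyl sum `U = Σ_{x,y≤a} e(α·ν(xy))` for the SPECIFIC
Taylor coefficients `α = αv t u r n` of the zeta sum; its proof, however, uses only

* Korobov's bound `VKZeta.norm_Usum_pow_le` (valid for every `α`),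
* the trivial factor bound `VKZeta.mnSum_le_sq` and, for the `G ∈ [1.5Y − 1, 1.5Y + 1]` good indices
  `j ∈ [M₂, M₃)`, a bound `factor_j ≤ (2A_j)² θ*` with `θ* = VKZeta.thetaStar L Y = L e^{21Y − 0.3YL}`,
* the mean value bound `hJ` (the tree's `VKZeta.J_le_four`) and the exponent bookkeeping `VKZeta.numerics`.

This file records that generic statement (`norm_Usum_le_of_good`), so that the `q`-aspect (where the good
factors come from `2`-power denominators, `…BilinearSieveKorobovFactors.lean`) can use the same numerics:
with `Y = log q/log N ≥ 10`, `L = log N ≥ 10⁶Y²`, `4.91Y ≤ r ≤ 5.01Y`, `k = 5r²`, `a ≤ N^{0.4}`: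
`‖U‖ ≤ a² e^{B²/2+2} exp(−2·10⁻⁶ L/Y²)`.

* `prod_mnSum_le_of_good` — the product step over `Fin r`;
* `norm_Usum_le_of_good` — ★ the generic Korobov step.

HONEST FRAMING. Helper lemmas only (unconditional, pure real analysis on the tree's `VKZeta` objects); the leaf
`AlignedTypeI` is NOT closed here; nothing bears on `VP ≠ VNP` (NOT proved).
-/

set_option linter.dupNamespace false

noncomputable section

namespace Summit.ValiantsHypothesis.ValiantsHypothesis.Theorems.LiouvilleSarnak.AlignedTypeI.CharactersModTwoN

open Finset Real
open Literature.NumberTheory.LFunctions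
open Literature.NumberTheory.LFunctions.VMV (J)
open Literature.NumberTheory.LFunctions.VKZeta (Usum mnSum Abnd thetaStar mnSum_le_sq mnSum_nonneg
  norm_Usum_pow_le numerics one_sub_inv_pow_le sum_log_sq)

/-! ### The product of the factors -/

/-- **The product step over `Fin r`**: if the factors with index in `[M₂, M₃)` are `≤ (2A_j)² θ` (
`k, a ≥ 1`), then `∏_j factor_j ≤ (∏_{i<r} (2ka^{i+1})²) θ^{M₃−M₂}` (the others by `VKZeta.mnSum_le_sq`).
[cite: Ivic1985, p. 156] -/
theorem prod_mnSum_le_of_good {r k a M₂ M₃ : ℕ} {θ : ℝ} (α : Fin r → ℝ) (hk : 1 ≤ k) (ha : 1 ≤ a)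
    (hM : M₃ ≤ r)
    (hgood : ∀ j : Fin r, j.val ∈ Ico M₂ M₃ → mnSum k a α j ≤ (2 * (Abnd k a j : ℝ)) ^ 2 * θ) :
    ∏ j, mnSum k a α j ≤
      (∏ i ∈ range r, (2 * ((k * a ^ (i + 1) : ℕ) : ℝ)) ^ 2) * θ ^ (M₃ - M₂) := by
  classical
  set g : ℕ → ℝ := fun i => (2 * ((k * a ^ (i + 1) : ℕ) : ℝ)) ^ 2 * (if i ∈ Ico M₂ M₃ then θ else 1) with hg
  have hA : ∀ j : Fin r, 1 ≤ Abnd k a j := fun j =>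
    Nat.one_le_iff_ne_zero.2 (Nat.mul_ne_zero (Nat.one_le_iff_ne_zero.1 hk)
      (pow_ne_zero _ (Nat.one_le_iff_ne_zero.1 ha)))
  have hAcast : ∀ j : Fin r, (Abnd k a j : ℝ) = ((k * a ^ (j.val + 1) : ℕ) : ℝ) := fun j => by
    unfold Abnd; rfl
  have h1 : ∏ j : Fin r, mnSum k a α j ≤ ∏ j : Fin r, g j.val := by
    refine prod_le_prod (fun j _ => mnSum_nonneg _ _ _ _) fun j _ => ?_
    simp only [hg]
    split_ifs with hj
    · rw [← hAcast]; exact hgood j hj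
    · rw [mul_one, ← hAcast]; exact mnSum_le_sq k a α j (hA j)
  refine h1.trans (le_of_eq ?_)
  rw [Fin.prod_univ_eq_prod_range g r]
  simp only [hg]
  rw [prod_mul_distrib, prod_ite_mem]
  have hsub : range r ∩ Ico M₂ M₃ = Ico M₂ M₃ := by
    ext i; simp only [mem_inter, mem_range, mem_Ico]; omega
  rw [hsub, prod_const, Nat.card_Ico]

/-! ### The generic Korobov step -/

/-- ★ **The Korobov step for an arbitrary phase** (Ivić pp. 156–159, the proof of the tree's
`VKZeta.norm_Usum_le` with the coefficient-specific factor bound replaced by the hypothesis `hgood`): for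
`Y ≥ 10`, `L ≥ 10⁶Y²`, `4.91Y ≤ r ≤ 5.01Y`, `r ≥ 50`, `k = 5r²`, `1 ≤ a ≤ e^{0.4L}`, good factors
`≤ (2A_j)² θ*(L,Y)` for `j ∈ [M₂, M₃)` with `M₃ − M₂ ∈ [1.5Y − 1, 1.5Y + 1]`, and the mean value bound `hJ`
(`VKZeta.J_le_four` gives it with `B = 4`): `‖U‖ ≤ a² e^{B²/2 + 2} exp(−2·10⁻⁶ L/Y²)`.
[cite: Ivic1985, Theorem 6.2, (6.44)–(6.46)] -/
theorem norm_Usum_le_of_good {B : ℝ} (hB : 1 ≤ B) {L Y : ℝ} {r k a M₂ M₃ : ℕ} (α : Fin r → ℝ)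
    (hY : 10 ≤ Y) (hL : (10 : ℝ) ^ 6 * Y ^ 2 ≤ L)
    (hr1 : 4.91 * Y ≤ r) (hr2 : (r : ℝ) ≤ 5.01 * Y) (hr50 : 50 ≤ r) (hk : k = 5 * r ^ 2)
    (ha1 : 1 ≤ a) (hahi : (a : ℝ) ≤ Real.exp (0.4 * L)) (hM : M₃ ≤ r)
    (hgood : ∀ j : Fin r, j.val ∈ Ico M₂ M₃ → mnSum k a α j ≤ (2 * (Abnd k a j : ℝ)) ^ 2 * thetaStar L Y)
    (hG1 : 1.5 * Y - 1 ≤ ((M₃ - M₂ : ℕ) : ℝ)) (hG2 : ((M₃ - M₂ : ℕ) : ℝ) ≤ 1.5 * Y + 1)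
    (hJ : (J r k (Icc (1 : ℤ) a) : ℝ) ≤ (B * r) ^ (B * k * (((4 * r : ℕ) : ℝ) + 1)) *
      (a : ℝ) ^ ((2 * k : ℝ) - ((r : ℝ) ^ 2 + r) / 2 + ((r : ℝ) ^ 2 + r) / 2 * (1 - 1 / (r : ℝ)) ^ (4 * r))) :
    ‖Usum a α‖ ≤ (a : ℝ) ^ 2 * Real.exp (B ^ 2 / 2 + 2) * Real.exp (-(2e-6 * L / Y ^ 2)) := by
  -- basic facts
  have hY0 : 0 < Y := by linarith
  have hY2 : 100 ≤ Y ^ 2 := by nlinarith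
  have hL100 : 100 ≤ L := by nlinarith
  have hL0 : 0 < L := by linarith
  have ha0 : (0 : ℝ) < a := by exact_mod_cast ha1
  have hr1' : 1 ≤ r := by omega
  have hrR : (50 : ℝ) ≤ r := by exact_mod_cast hr50
  have hk1 : 1 ≤ k := by rw [hk]; nlinarith
  have hkR : (k : ℝ) = 5 * (r : ℝ) ^ 2 := by rw [hk]; push_cast; ring
  have hk0 : (0 : ℝ) < k := by rw [hkR]; positivity
  set la := Real.log a with hla_def
  have hla0 : 0 ≤ la := Real.log_nonneg (by exact_mod_cast ha1)
  have hla : la ≤ 0.4 * L := by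
    have := Real.log_le_log ha0 hahi
    rw [Real.log_exp] at this; linarith
  -- the product of the factors
  set θs := thetaStar L Y with hθs
  have hθs0 : 0 < θs := by rw [hθs]; unfold thetaStar; positivity
  set Psq := ∏ i ∈ range r, (2 * ((k * a ^ (i + 1) : ℕ) : ℝ)) ^ 2 with hPsq
  have hPsq0 : 0 < Psq := by rw [hPsq]; exact prod_pos fun i _ => by positivity
  have hprod : ∏ j, mnSum k a α j ≤ Psq * θs ^ (M₃ - M₂) :=
    prod_mnSum_le_of_good α hk1 ha1 hM hgood
  -- Korobov's bound and the mean value bound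
  have hX := norm_Usum_pow_le ha1 hk1 α
  set w := (1 - 1 / (r : ℝ)) ^ (4 * r) with hw_def
  have hw0 : 0 ≤ w := by
    rw [hw_def]; apply pow_nonneg
    rw [sub_nonneg, div_le_one (by positivity)]; linarith
  have hw : w ≤ 0.0184 := one_sub_inv_pow_le hr1'
  set eJ : ℝ := (2 * k : ℝ) - ((r : ℝ) ^ 2 + r) / 2 + ((r : ℝ) ^ 2 + r) / 2 * w with heJ
  set e₁ : ℝ := B * k * (((4 * r : ℕ) : ℝ) + 1) with he₁
  set JB : ℝ := (B * r) ^ e₁ * (a : ℝ) ^ eJ with hJB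
  have hBr : 0 < B * r := by positivity
  have hJB0 : 0 < JB := by rw [hJB]; exact mul_pos (Real.rpow_pos_of_pos hBr _) (Real.rpow_pos_of_pos ha0 _)
  have hJ' : (J r k (Icc (1 : ℤ) a) : ℝ) ≤ JB := by
    rw [hJB, he₁, heJ, hw_def]
    convert hJ using 2
  have hJ0 : (0 : ℝ) ≤ J r k (Icc (1 : ℤ) a) := by positivity
  set X' : ℝ := JB ^ 2 * (a : ℝ) ^ (8 * k ^ 2 - 4 * k) * (Psq * θs ^ (M₃ - M₂)) with hX'
  have hXX : ‖Usum a α‖ ^ (4 * k ^ 2) ≤ X' := by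
    refine hX.trans ?_
    rw [hX']
    apply mul_le_mul _ hprod (prod_nonneg fun j _ => mnSum_nonneg _ _ _ _) (by positivity)
    exact mul_le_mul_of_nonneg_right (pow_le_pow_left₀ hJ0 hJ' 2) (by positivity)
  -- the case `U = 0`
  rcases eq_or_lt_of_le (norm_nonneg (Usum a α)) with h0 | hUpos
  · rw [← h0]; positivity
  -- logarithms
  have hX'0 : 0 < X' := by rw [hX']; positivity
  have hlogle : ((4 * k ^ 2 : ℕ) : ℝ) * Real.log ‖Usum a α‖ ≤ Real.log X' := by
    rw [← Real.log_pow]; exact Real.log_le_log (pow_pos hUpos _) hXX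
  have hlogX' : Real.log X' = 2 * (e₁ * Real.log (B * r) + eJ * la) + ((8 * k ^ 2 - 4 * k : ℕ) : ℝ) * la +
      (2 * r * Real.log (2 * k) + r * (r + 1) * la) + (M₃ - M₂ : ℕ) * (Real.log L + (21 * Y - 0.3 * Y * L)) := by
    rw [hX']
    have hne1 : JB ^ 2 ≠ 0 := by positivity
    have hne2 : (a : ℝ) ^ (8 * k ^ 2 - 4 * k) ≠ 0 := by positivity
    have hne3 : Psq ≠ 0 := hPsq0.ne'
    have hne4 : θs ^ (M₃ - M₂) ≠ 0 := by positivity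
    rw [Real.log_mul (mul_ne_zero hne1 hne2) (mul_ne_zero hne3 hne4), Real.log_mul hne1 hne2,
      Real.log_mul hne3 hne4, Real.log_pow, Real.log_pow, Real.log_pow]
    have hlJB : Real.log JB = e₁ * Real.log (B * r) + eJ * la := by
      rw [hJB, Real.log_mul (Real.rpow_pos_of_pos hBr _).ne' (Real.rpow_pos_of_pos ha0 _).ne',
        Real.log_rpow hBr, Real.log_rpow ha0]
    have hlP : Real.log Psq = 2 * r * Real.log (2 * k) + r * (r + 1) * la := by
      rw [hPsq, Real.log_prod fun i _ => by positivity]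
      exact sum_log_sq k a r hk0 ha0
    have hlθ : Real.log θs = Real.log L + (21 * Y - 0.3 * Y * L) := by
      rw [hθs]; unfold thetaStar
      rw [Real.log_mul hL0.ne' (Real.exp_pos _).ne', Real.log_exp]
    rw [hlJB, hlP, hlθ]
    push_cast
    ring
  -- the bookkeeping
  have hcast1 : ((8 * k ^ 2 - 4 * k : ℕ) : ℝ) = 8 * (k : ℝ) ^ 2 - 4 * k := by
    have : 4 * k ≤ 8 * k ^ 2 := by nlinarith
    push_cast [Nat.cast_sub this]; ring
  have hcast2 : ((4 * k ^ 2 : ℕ) : ℝ) = 4 * (k : ℝ) ^ 2 := by push_cast; ring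
  set Λ := L / Y ^ 2 with hΛdef
  have hΛL : Λ * Y ^ 2 = L := by rw [hΛdef]; field_simp
  have hΛ : (10 : ℝ) ^ 6 ≤ Λ := by
    rw [hΛdef, le_div_iff₀ (by positivity)]; linarith
  have hnum := numerics (B := B) (Y := Y) (Λ := Λ) (la := la) (r := r) (w := w) (G := ((M₃ - M₂ : ℕ) : ℝ))
    hB hY hΛ hla0 (by rw [hΛL]; exact hla) hr1 hr2 hrR hw0 hw hG1 hG2
  rw [hΛL] at hnum
  have hmain : 4 * (k : ℝ) ^ 2 * Real.log ‖Usum a α‖ ≤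
      4 * (k : ℝ) ^ 2 * (2 * la + B ^ 2 / 2 + 2 - 2e-6 * Λ) := by
    rw [hcast2] at hlogle
    rw [hlogX', hcast1] at hlogle
    refine hlogle.trans ?_
    have e4r : (((4 * r : ℕ) : ℝ) + 1) = 4 * (r : ℝ) + 1 := by push_cast; ring
    rw [he₁, heJ, e4r, hkR]
    linarith [hnum]
  have hlogU : Real.log ‖Usum a α‖ ≤ 2 * la + B ^ 2 / 2 + 2 - 2e-6 * Λ :=
    le_of_mul_le_mul_left hmain (by positivity)
  calc ‖Usum a α‖ = Real.exp (Real.log ‖Usum a α‖) := (Real.exp_log hUpos).symm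
    _ ≤ Real.exp (2 * la + B ^ 2 / 2 + 2 - 2e-6 * Λ) := Real.exp_le_exp.2 hlogU
    _ = (a : ℝ) ^ 2 * Real.exp (B ^ 2 / 2 + 2) * Real.exp (-(2e-6 * L / Y ^ 2)) := by
        rw [show 2 * la + B ^ 2 / 2 + 2 - 2e-6 * Λ = 2 * la + (B ^ 2 / 2 + 2) + (-(2e-6 * L / Y ^ 2)) by
          rw [hΛdef]; ring, Real.exp_add, Real.exp_add]
        congr 2
        rw [hla_def, show (2 : ℝ) * Real.log (a : ℝ) = Real.log ((a : ℝ) ^ 2) by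
          rw [Real.log_pow]; norm_num, Real.exp_log (by positivity)]

end Summit.ValiantsHypothesis.ValiantsHypothesis.Theorems.LiouvilleSarnak.AlignedTypeI.CharactersModTwoN
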